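import Literature.NumberTheory.LFunctions.ConeCharacterSums
import Literature.NumberTheory.LFunctions.ConeCharacterExistence
import Literature.NumberTheory.LFunctions.PrimesInRayClasses
import Literature.NumberTheory.LFunctions.RayClassLSeriesAtOneProofs
import Literature.Algebra.EuclideanLattices.MitsuiSummation
import Mathlib.NumberTheory.NumberField.DedekindZeta
import HarnessLib

/-!
# Weyl sums over the narrow-principal ideals and primes: Hecke's equidistribution theorem

Topic `Literature/NumberTheory/LFunctions`. For a totally real number field `K` let `P⁺` be the set
of nonzero ideals having a totally positive generator (`IsPosPrincipal`), `L⁺ ⊂ logSpace K` the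
lattice of logarithms of the totally positive units (`posUnitLattice`), and attach to `𝔞 ∈ P⁺` the
point `logMap (ι β) ∈ logSpace K` of a totally positive generator `β` (`logPt`; well defined
mod `L⁺`). We prove that

* the prime ideals `𝔭 ∈ P⁺`, counted with norm `≤ x`, are **equidistributed mod `L⁺` with density
  `1/h⁺` and normalisation `x/log x`** (`equidistributed_primes`), and
* the ideals `𝔞 ∈ P⁺` are **equidistributed mod `L⁺` with density `ρ_K/h⁺` and normalisation `x`**
  (`equidistributed_ideals`),

in the sense of `MitsuiSum.Equidistributed` (`h⁺` = order of the narrow class group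
`RayClassGroup ⊤`, `ρ_K` = Mathlib's `dedekindZeta_residue K`, the ideal density). Proof: Weyl's criterion
(`LatticePeriodic.tendsto_sum_of_tendsto_echar`); the characters of `logSpace K / L⁺` are the values
on `P⁺` of Hecke's cone characters (`exists_isConeChar`), `P⁺` is cut out of all ideals by the
characters of the narrow class group (orthogonality), and the resulting character sums are `o(x/log x)`
over primes (`tendsto_sum_primes_mul_log_div` of `ConeCharacterSums`, Hecke 1920 §7) resp. `O(x^{1−1/(2d)})` over ideals
(`norm_sum_twistCount_le`), while the principal terms are the narrow-class prime number theorem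
(`AbelianDensity`) resp. Mathlib's ideal count. Everything here is PROVED.

## References

* E. Hecke, *Eine neue Art von Zetafunktionen …* II, Math. Z. 6 (1920), 11–51, §6–§7. [HeckeMathZ1920]
* T. Mitsui, *Generalized prime number theorem*, Jap. J. Math. 26 (1956), 1–42. [cite: Mitsui1956, §3]
-/

noncomputable section

open Filter NumberField NumberField.InfinitePlace NumberField.mixedEmbedding NumberField.Units
  NumberField.Units.dirichletUnitTheorem IsDedekindDomain Complex Finset Topology Module
open Literature.Algebra.EuclideanLattices Literature.Algebra.EuclideanLattices.LatticePeriodic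
open Literature.NumberTheory.GaloisRepresentations Literature.NumberTheory.LFunctions.AbelianDensity

open scoped Classical ComplexConjugate Real

namespace Literature.NumberTheory.LFunctions.HeckeCone

variable {K : Type*} [Field K] [NumberField K]

/-! ## Totally positive generators and the narrow-principal ideals `P⁺` -/

variable (K) in
/-- **`𝔞 ∈ P⁺`**: `𝔞` is principal with a totally positive generator. [cite: HeckeMathZ1920, §1] -/
def IsPosPrincipal (I : Ideal (𝓞 K)) : Prop :=
  ∃ β : 𝓞 K, β ≠ 0 ∧ NumberField.IsTotPos K (β : K) ∧ I = Ideal.span {β}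

/-- A chosen totally positive generator (junk value `1` off `P⁺`). [folklore] -/
def posGen (I : Ideal (𝓞 K)) : 𝓞 K := if h : IsPosPrincipal K I then h.choose else 1

omit [NumberField K] in
/-- The defining properties of `posGen`. [folklore] -/
theorem posGen_spec {I : Ideal (𝓞 K)} (h : IsPosPrincipal K I) :
    posGen I ≠ 0 ∧ NumberField.IsTotPos K (posGen I : K) ∧ I = Ideal.span {posGen I} := by
  rw [posGen, dif_pos h]; exact h.choose_spec

omit [NumberField K] in
/-- An ideal of `P⁺` is nonzero. [folklore] -/
theorem IsPosPrincipal.ne_bot {I : Ideal (𝓞 K)} (h : IsPosPrincipal K I) : I ≠ ⊥ := by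
  obtain ⟨β, hβ, -, rfl⟩ := h
  rwa [Ne, Ideal.span_singleton_eq_bot]

variable (K) in
/-- The logarithmic point of an ideal of `P⁺`: `logMap (ι β)` for the chosen generator. [folklore] -/
def logPt (I : Ideal (𝓞 K)) : logSpace K := logMap (mixedEmbedding K (posGen I : K))

/-! ## The narrow class group and its characters on the ideals -/

/-- `(1) ≠ (0)`. [folklore] -/
theorem top_ne_bot_ideal : (⊤ : Ideal (𝓞 K)) ≠ ⊥ := by
  intro h
  have : (1 : 𝓞 K) ∈ (⊥ : Ideal (𝓞 K)) := h ▸ Submodule.mem_top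
  exact one_ne_zero ((Submodule.mem_bot _).1 this)

omit [NumberField K] in
/-- Every ideal is prime to `(1)`. [folklore] -/
theorem isCoprime_top (I : Ideal (𝓞 K)) : IsCoprime I (⊤ : Ideal (𝓞 K)) :=
  Ideal.isCoprime_iff_sup_eq.2 (sup_top_eq I)

variable (K) in
/-- The narrow class group `Cl⁺ = Cl_K^{(1)}`. [cite: NeukirchANT1999, Ch. VI §1 Def. (1.7)] -/
abbrev NCl : Type _ := RayClassGroup (⊤ : Ideal (𝓞 K))

/-- The narrow class group is finite. [cite: NeukirchANT1999, Ch. VI §1 Prop. (1.8)] -/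
instance instFiniteNCl : Finite (NCl K) := finite_rayClassGroup top_ne_bot_ideal

/-- The (finite) set of characters of the narrow class group. [folklore] -/
instance instFintypeAddCharNCl : Fintype (AddChar (Additive (NCl K)) ℂ) :=
  @AddChar.instFintype (Additive (NCl K)) ℂ _ _ _

/-- The narrow class of an ideal (junk value `1` at the zero ideal). [folklore] -/
def nclass (I : Ideal (𝓞 K)) : NCl K :=
  if h : I = ⊥ then 1 else integralRayClass ⊤ top_ne_bot_ideal ⟨I, h, isCoprime_top I⟩

/-- Unfolding `nclass` off the zero ideal. [folklore] -/
theorem nclass_of_ne_bot {I : Ideal (𝓞 K)} (h : I ≠ ⊥) :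
    nclass I = integralRayClass ⊤ top_ne_bot_ideal ⟨I, h, isCoprime_top I⟩ := by
  rw [nclass, dif_neg h]

/-- `nclass` is multiplicative on nonzero ideals. [folklore] -/
theorem nclass_mul {I J : Ideal (𝓞 K)} (hI : I ≠ ⊥) (hJ : J ≠ ⊥) : nclass (I * J) = nclass I * nclass J := by
  have hIJ : I * J ≠ ⊥ := mul_ne_zero hI hJ
  rw [nclass_of_ne_bot hI, nclass_of_ne_bot hJ, nclass_of_ne_bot hIJ]
  exact integralRayClass_mul top_ne_bot_ideal ⟨I, hI, isCoprime_top I⟩ ⟨J, hJ, isCoprime_top J⟩ ⟨hIJ, isCoprime_top _⟩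

/-- The class of a prime is the tree's `primeRayClass`. [folklore] -/
theorem nclass_asIdeal (v : HeightOneSpectrum (𝓞 K)) : nclass v.asIdeal = primeRayClass ⊤ top_ne_bot_ideal v := by
  have hv : ¬ (⊤ : Ideal (𝓞 K)) ≤ v.asIdeal := fun h ↦ v.isPrime.ne_top (top_le_iff.1 h)
  rw [nclass_of_ne_bot v.ne_bot, primeRayClass_of_not_le top_ne_bot_ideal hv ⟨v.ne_bot, isCoprime_top _⟩]

/-- **The trivial narrow class is `P⁺`**: `[𝔞] = 1 ↔ 𝔞` has a totally positive generator.
[cite: NeukirchANT1999, Ch. VI §1 Prop. (1.9)] -/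
theorem nclass_eq_one_iff {I : Ideal (𝓞 K)} (hI : I ≠ ⊥) : nclass I = 1 ↔ IsPosPrincipal K I := by
  rw [nclass_of_ne_bot hI, ← integralRayClass_top top_ne_bot_ideal ⟨top_ne_bot_ideal, isCoprime_top _⟩, eq_comm,
    integralRayClass_eq_iff]
  change RayClassRel ⊤ ⊤ I ↔ _
  have h := rayClassRel_iff_exists_gen (𝔪 := ⊤) (𝔟 := ⊤) (𝔠 := ⊤) (β₀ := (1 : 𝓞 K)) (K := K) top_ne_bot_ideal
    top_ne_bot_ideal (isCoprime_top _) (by rw [Ideal.span_singleton_one]; exact Ideal.top_mul ⊤)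
    (fun φ ↦ by simp) I
  rw [h]
  constructor
  · rintro ⟨α, hα0, hα, -, hpos⟩
    refine ⟨α, hα0, (NumberField.isTotPos_iff_forall_ringHom _).2 hpos, ?_⟩
    rwa [Ideal.mul_top] at hα
  · rintro ⟨β, hβ0, hpos, rfl⟩
    exact ⟨β, hβ0, by rw [Ideal.mul_top], Submodule.mem_top, (NumberField.isTotPos_iff_forall_ringHom _).1 hpos⟩

/-- The character of the ideals attached to a character of the narrow class group
(`0` at the zero ideal). [folklore] -/
def nchar (χ : AddChar (Additive (NCl K)) ℂ) : Ideal (𝓞 K) →*₀ ℂ where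
  toFun I := if I = ⊥ then 0 else toMulHom χ (nclass I)
  map_zero' := by simp
  map_one' := by
    show (if (1 : Ideal (𝓞 K)) = ⊥ then 0 else toMulHom χ (nclass 1)) = 1
    rw [Ideal.one_eq_top, if_neg (top_ne_bot_ideal (K := K)), nclass_of_ne_bot top_ne_bot_ideal,
      integralRayClass_top top_ne_bot_ideal, map_one]
  map_mul' I J := by
    by_cases hI : I = ⊥
    · simp [hI]
    by_cases hJ : J = ⊥
    · simp [hJ]
    have hIJ : I * J ≠ ⊥ := Ideal.mul_eq_bot.not.2 (not_or.2 ⟨hI, hJ⟩)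
    show (if I * J = ⊥ then 0 else toMulHom χ (nclass (I * J))) =
      (if I = ⊥ then 0 else toMulHom χ (nclass I)) * (if J = ⊥ then 0 else toMulHom χ (nclass J))
    rw [if_neg hIJ, if_neg hI, if_neg hJ, nclass_mul hI hJ, map_mul]

/-- Unfolding `nchar` off the zero ideal. [folklore] -/
theorem nchar_apply_of_ne_bot (χ : AddChar (Additive (NCl K)) ℂ) {I : Ideal (𝓞 K)} (hI : I ≠ ⊥) :
    nchar χ I = toMulHom χ (nclass I) := by
  show (if I = ⊥ then 0 else toMulHom χ (nclass I)) = _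
  rw [if_neg hI]

/-- `nchar χ` is a cone character of frequency `0`. [folklore] -/
theorem isConeChar_nchar (χ : AddChar (Additive (NCl K)) ℂ) : IsConeChar K (nchar χ) 0 where
  norm_eq_one I hI := by rw [nchar_apply_of_ne_bot χ hI, norm_toMulHom]
  apply_span_eq β hβ hpos := by
    have hI : Ideal.span {β} ≠ ⊥ := by rwa [Ne, Ideal.span_singleton_eq_bot]
    rw [nchar_apply_of_ne_bot χ hI, (nclass_eq_one_iff hI).2 ⟨β, hβ, hpos, rfl⟩, map_one]
    unfold eTwist; simp

/-- **Orthogonality**: `∑_χ nchar χ 𝔞 = h⁺ · [𝔞 ∈ P⁺]` for `𝔞 ≠ 0`. [folklore] -/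
theorem sum_nchar {I : Ideal (𝓞 K)} (hI : I ≠ ⊥) :
    ∑ χ : AddChar (Additive (NCl K)) ℂ, nchar χ I = if IsPosPrincipal K I then (Nat.card (NCl K) : ℂ) else 0 := by
  have h := sum_char_inv_mul (G := NCl K) (1 : NCl K) (nclass I)
  simp only [ofMul_one, AddChar.map_zero_eq_one, inv_one, one_mul] at h
  simp only [nchar_apply_of_ne_bot _ hI, h, nclass_eq_one_iff hI]

/-- A non-trivial character of `Cl⁺` is `≠ 1` on some nonzero ideal. [folklore] -/
theorem exists_nchar_ne_one {χ : AddChar (Additive (NCl K)) ℂ} (hχ : χ ≠ 0) :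
    ∃ I : Ideal (𝓞 K), I ≠ ⊥ ∧ nchar χ I ≠ 1 := by
  obtain ⟨v, -, hv⟩ := exists_charFun_primeRayClass_ne_one top_ne_bot_ideal χ hχ
  refine ⟨v.asIdeal, v.ne_bot, ?_⟩
  rwa [nchar_apply_of_ne_bot χ v.ne_bot, toMulHom_apply, nclass_asIdeal]

/-- The order of the narrow class group is positive. [folklore] -/
theorem card_NCl_pos : 0 < Nat.card (NCl K) := Nat.card_pos

/-! ## The lattice of logarithms of the totally positive units -/

variable (K) in
/-- **`L⁺`**: the logarithms of the totally positive units, a full lattice in `logSpace K`.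
[cite: HeckeMathZ1920, §1] -/
def posUnitLattice : Submodule ℤ (logSpace K) :=
  Submodule.span ℤ (Set.range fun u : posUnits K ↦ logEmbedding K (Additive.ofMul (u : (𝓞 K)ˣ)))

/-- Logarithms of totally positive units lie in `L⁺`. [folklore] -/
theorem logEmbedding_mem_posUnitLattice {u : (𝓞 K)ˣ} (hu : u ∈ posUnits K) :
    logEmbedding K (Additive.ofMul u) ∈ posUnitLattice K :=
  Submodule.subset_span ⟨⟨u, hu⟩, rfl⟩

/-- Every element of `L⁺` is the logarithm of a totally positive unit. [folklore] -/
theorem exists_of_mem_posUnitLattice {x : logSpace K} (hx : x ∈ posUnitLattice K) :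
    ∃ u : (𝓞 K)ˣ, u ∈ posUnits K ∧ logEmbedding K (Additive.ofMul u) = x := by
  induction hx using Submodule.span_induction with
  | mem x hx =>
    obtain ⟨u, rfl⟩ := hx
    exact ⟨u, u.2, rfl⟩
  | zero => exact ⟨1, (posUnits K).one_mem, by simp⟩
  | add x y _ _ hx hy =>
    obtain ⟨u, hu, rfl⟩ := hx
    obtain ⟨v, hv, rfl⟩ := hy
    exact ⟨u * v, (posUnits K).mul_mem hu hv, by rw [ofMul_mul, map_add]⟩
  | smul n x _ hx =>
    obtain ⟨u, hu, rfl⟩ := hx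
    exact ⟨u ^ n, (posUnits K).zpow_mem hu n, by rw [ofMul_zpow, map_zsmul]⟩

/-- `L⁺` is contained in the unit lattice. [folklore] -/
theorem posUnitLattice_le : posUnitLattice K ≤ unitLattice K := by
  refine Submodule.span_le.2 ?_
  rintro _ ⟨u, rfl⟩
  exact ⟨Additive.ofMul (u : (𝓞 K)ˣ), trivial, rfl⟩

/-- Squares of units are totally positive. [folklore] -/
theorem sq_mem_posUnits (u : (𝓞 K)ˣ) : u ^ 2 ∈ posUnits K := by
  intro φ
  have : (((u ^ 2 : (𝓞 K)ˣ) : 𝓞 K) : K) = (((u : 𝓞 K) : K)) ^ 2 := by push_cast; rfl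
  rw [this, map_pow]
  have h0 : φ ((u : 𝓞 K) : K) ≠ 0 := (map_ne_zero φ).2 (by exact_mod_cast u.ne_zero)
  positivity

/-- `L⁺` is discrete (a subgroup of the unit lattice). [folklore] -/
instance instDiscreteTopologyPosUnitLattice : DiscreteTopology (posUnitLattice K) :=
  DiscreteTopology.of_subset (inferInstance : DiscreteTopology (unitLattice K)) posUnitLattice_le

/-- `L⁺` is a full lattice: it contains the logarithms of the squares of all units. [folklore] -/
instance instIsZLatticePosUnitLattice : IsZLattice ℝ (posUnitLattice K) := by
  refine ⟨?_⟩
  have htop := (inferInstance : IsZLattice ℝ (unitLattice K)).span_top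
  rw [eq_top_iff, ← htop]
  refine Submodule.span_le.2 fun x hx ↦ ?_
  obtain ⟨u, -, hu⟩ := Submodule.mem_map.1 hx
  have hx' : x = logEmbedding K u := by rw [← hu]; rfl
  set v : (𝓞 K)ˣ := Additive.toMul u with hv
  have h2 : (2 : ℝ) • x ∈ (posUnitLattice K : Set (logSpace K)) := by
    have : (2 : ℝ) • x = logEmbedding K (Additive.ofMul (v ^ 2)) := by
      rw [ofMul_pow, map_nsmul, two_smul, two_nsmul, hx', hv, ofMul_toMul]
    rw [this]
    exact logEmbedding_mem_posUnitLattice (sq_mem_posUnits v)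
  have : x = (1 / 2 : ℝ) • ((2 : ℝ) • x) := by rw [smul_smul]; norm_num
  rw [this]
  exact Submodule.smul_mem _ _ (Submodule.subset_span h2)

/-- Membership in `posUnits`. [folklore] -/
theorem mem_posUnits_iff {u : (𝓞 K)ˣ} : u ∈ posUnits K ↔ NumberField.IsTotPos K ((u : 𝓞 K) : K) := by
  rw [NumberField.isTotPos_iff_forall_ringHom]; rfl

/-! ## Frequencies: the characters of `logSpace K / L⁺` as cone characters -/

variable (K) in
/-- The linear form `∑ᵢ kᵢ · (i-th coordinate in the basis of L⁺)`. [folklore] -/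
def freqForm (k : Fin (finrank ℝ (logSpace K)) → ℤ) : logSpace K →ₗ[ℝ] ℝ :=
  ∑ i, (k i : ℝ) • (rBasis (posUnitLattice K)).coord i

/-- Unfolding `freqForm`. [folklore] -/
theorem freqForm_apply (k : Fin (finrank ℝ (logSpace K)) → ℤ) (x : logSpace K) :
    freqForm K k x = ∑ i, (k i : ℝ) * (rBasis (posUnitLattice K)).repr x i := by
  simp [freqForm, LinearMap.sum_apply, Basis.coord_apply]

/-- The characters of `logSpace K / L⁺` through `freqForm`. [folklore] -/
theorem echar_eq_exp_freqForm (k : Fin (finrank ℝ (logSpace K)) → ℤ) (x : logSpace K) :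
    echar (posUnitLattice K) k x = Complex.exp (2 * π * Complex.I * (freqForm K k x : ℝ)) := by
  rw [echar, freqForm_apply]

/-- `freqForm k` is integral on the logarithms of the totally positive units. [folklore] -/
theorem freqForm_logEmbedding_int (k : Fin (finrank ℝ (logSpace K)) → ℤ) {u : (𝓞 K)ˣ} (hu : u ∈ posUnits K) :
    ∃ N : ℤ, freqForm K k (logEmbedding K (Additive.ofMul u)) = N := by
  choose f hf using fun i ↦ rBasis_repr_of_mem (posUnitLattice K) (logEmbedding_mem_posUnitLattice hu) i
  refine ⟨∑ i, k i * f i, ?_⟩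
  rw [freqForm_apply]; push_cast
  exact Finset.sum_congr rfl fun i _ ↦ by rw [hf i]

/-- `freqForm k` on the basis of `L⁺` recovers `k`. [folklore] -/
theorem freqForm_rBasis (k : Fin (finrank ℝ (logSpace K)) → ℤ) (j : Fin (finrank ℝ (logSpace K))) :
    freqForm K k (rBasis (posUnitLattice K) j) = k j := by
  rw [freqForm_apply]
  simp only [Basis.repr_self, Finsupp.single_apply, mul_ite, mul_one, mul_zero]
  rw [Finset.sum_ite_eq]; simp

variable (K) in
/-- The frequency vector (in Mathlib's `logBasis` coordinates) attached to `k`. [folklore] -/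
def freq (k : Fin (finrank ℝ (logSpace K)) → ℤ) : Fin (rank K) → ℝ := fun i ↦ freqForm K k (logBasis K i)

/-- A nonzero `k` has a nonzero frequency. [folklore] -/
theorem freq_ne_zero {k : Fin (finrank ℝ (logSpace K)) → ℤ} (hk : k ≠ 0) : ∃ i, freq K k i ≠ 0 := by
  by_contra h
  push Not at h
  have hzero : freqForm K k = 0 := (logBasis K).ext fun i ↦ by rw [LinearMap.zero_apply]; exact h i
  apply hk
  funext j
  have := freqForm_rBasis k j
  rw [hzero, LinearMap.zero_apply] at this
  exact_mod_cast this.symm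

/-- **Cone characters of every frequency of `logSpace K / L⁺` exist** (Hecke's Grössencharaktere
mod `1`). [cite: HeckeMathZ1920, §1] -/
theorem exists_coneChar_freq (k : Fin (finrank ℝ (logSpace K)) → ℤ) :
    ∃ ν : Ideal (𝓞 K) →*₀ ℂ, IsConeChar K ν (freq K k) :=
  exists_isConeChar (freqForm K k) fun _ hu ↦ freqForm_logEmbedding_int k (mem_posUnits_iff.2 hu)

/-- The value of a cone character of frequency `freq k` on `(β)`, `β ≫ 0`, is the character `e_k`
of `logSpace K / L⁺` at `logMap (ι β)`. [folklore] -/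
theorem IsConeChar.apply_span_eq_echar {ν : Ideal (𝓞 K) →*₀ ℂ} {k : Fin (finrank ℝ (logSpace K)) → ℤ}
    (hν : IsConeChar K ν (freq K k)) {β : 𝓞 K} (hβ : β ≠ 0) (hpos : NumberField.IsTotPos K (β : K)) :
    ν (Ideal.span {β}) = echar (posUnitLattice K) k (logMap (mixedEmbedding K (β : K))) := by
  rw [hν.apply_span_eq β hβ hpos, show freq K k = fun i ↦ freqForm K k (logBasis K i) from rfl,
    eTwist_freq_eq, echar_eq_exp_freqForm]

/-- On `P⁺`, `e_k(logPt 𝔞) = ν(𝔞)` for a cone character of frequency `freq k`. [folklore] -/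
theorem echar_logPt_eq {ν : Ideal (𝓞 K) →*₀ ℂ} {k : Fin (finrank ℝ (logSpace K)) → ℤ}
    (hν : IsConeChar K ν (freq K k)) {I : Ideal (𝓞 K)} (hI : IsPosPrincipal K I) :
    echar (posUnitLattice K) k (logPt K I) = ν I := by
  obtain ⟨h0, hpos, heq⟩ := posGen_spec hI
  rw [logPt, ← hν.apply_span_eq_echar h0 hpos, ← heq]

/-! ## From `ℕ` to `ℝ`: the floor transfer -/

/-- `(log x)^κ/x ∼ (log ⌊x⌋)^κ/⌊x⌋`. [folklore] -/
theorem tendsto_weight_div_weight_floor (κ : ℕ) :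
    Tendsto (fun x : ℝ ↦ ((Real.log x) ^ κ / x) / ((Real.log ⌊x⌋₊) ^ κ / ⌊x⌋₊)) atTop (𝓝 1) := by
  have h1 : Tendsto (fun x : ℝ ↦ (⌊x⌋₊ : ℝ) / x) atTop (𝓝 1) := tendsto_nat_floor_div_atTop
  have h2 : Tendsto (fun x : ℝ ↦ x / (⌊x⌋₊ : ℝ)) atTop (𝓝 1) := by
    have := h1.inv₀ one_ne_zero
    rw [inv_one] at this
    exact this.congr fun x ↦ by rw [inv_div]
  have h3 : Tendsto (fun x : ℝ ↦ Real.log (x / (⌊x⌋₊ : ℝ))) atTop (𝓝 0) := by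
    have := (Real.continuousAt_log one_ne_zero).tendsto.comp h2
    rwa [Function.comp_def, Real.log_one] at this
  have h4 : Tendsto (fun x : ℝ ↦ Real.log (⌊x⌋₊ : ℝ)) atTop atTop :=
    Real.tendsto_log_atTop.comp (tendsto_natCast_atTop_atTop.comp tendsto_nat_floor_atTop)
  have h5 : Tendsto (fun x : ℝ ↦ Real.log (x / (⌊x⌋₊ : ℝ)) / Real.log (⌊x⌋₊ : ℝ)) atTop (𝓝 0) := h3.div_atTop h4
  have h6 : Tendsto (fun x : ℝ ↦ Real.log x / Real.log (⌊x⌋₊ : ℝ)) atTop (𝓝 1) := by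
    have h := (tendsto_const_nhds : Tendsto (fun _ : ℝ ↦ (1 : ℝ)) atTop (𝓝 1)).add h5
    rw [add_zero] at h
    refine h.congr' ?_
    filter_upwards [eventually_ge_atTop (3 : ℝ)] with x hx
    have hfl : (3 : ℝ) ≤ ⌊x⌋₊ := by
      have : (3 : ℕ) ≤ ⌊x⌋₊ := Nat.le_floor (by exact_mod_cast hx)
      exact_mod_cast this
    have hfl0 : (0 : ℝ) < ⌊x⌋₊ := by linarith
    have hlogfl : 0 < Real.log (⌊x⌋₊ : ℝ) := Real.log_pos (by linarith)
    have hx0 : 0 < x := by linarith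
    rw [Real.log_div hx0.ne' hfl0.ne']
    field_simp
    ring
  have h7 := (h6.pow κ).mul h1
  rw [one_pow, one_mul] at h7
  refine h7.congr' ?_
  filter_upwards [eventually_ge_atTop (3 : ℝ)] with x hx
  have hfl : (3 : ℝ) ≤ ⌊x⌋₊ := by
    have : (3 : ℕ) ≤ ⌊x⌋₊ := Nat.le_floor (by exact_mod_cast hx)
    exact_mod_cast this
  have hlogfl : 0 < Real.log (⌊x⌋₊ : ℝ) := Real.log_pos (by linarith)
  have hx0 : 0 < x := by linarith
  rw [div_pow]
  field_simp

/-- **Floor transfer**: a limit along `N → ∞` of `a_N (log N)^κ/N` gives the limit along real `x` of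
`a_{⌊x⌋} (log x)^κ/x`. [folklore] -/
theorem tendsto_floor_transfer {a : ℕ → ℂ} {A : ℂ} (κ : ℕ)
    (h : Tendsto (fun N : ℕ ↦ a N * (((Real.log N) ^ κ / N : ℝ) : ℂ)) atTop (𝓝 A)) :
    Tendsto (fun x : ℝ ↦ a ⌊x⌋₊ * (((Real.log x) ^ κ / x : ℝ) : ℂ)) atTop (𝓝 A) := by
  have h1 := h.comp (tendsto_nat_floor_atTop (α := ℝ))
  have h2 : Tendsto (fun x : ℝ ↦ ((((Real.log x) ^ κ / x) / ((Real.log ⌊x⌋₊) ^ κ / ⌊x⌋₊) : ℝ) : ℂ)) atTop (𝓝 1) := by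
    have := (Complex.continuous_ofReal.tendsto _).comp (tendsto_weight_div_weight_floor κ)
    rwa [Function.comp_def, Complex.ofReal_one] at this
  have h3 := h1.mul h2
  rw [mul_one] at h3
  refine h3.congr' ?_
  filter_upwards [eventually_ge_atTop (3 : ℝ)] with x hx
  have hfl : (3 : ℝ) ≤ ⌊x⌋₊ := by
    have : (3 : ℕ) ≤ ⌊x⌋₊ := Nat.le_floor (by exact_mod_cast hx)
    exact_mod_cast this
  have hlogfl : 0 < Real.log (⌊x⌋₊ : ℝ) := Real.log_pos (by linarith)
  have hw : (Real.log (⌊x⌋₊ : ℝ)) ^ κ / (⌊x⌋₊ : ℝ) ≠ 0 := by positivity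
  simp only [Function.comp_apply]
  rw [mul_assoc, ← Complex.ofReal_mul, mul_div_cancel₀ _ hw]

/-! ## The prime ideals of `P⁺` -/

variable (K) in
/-- The primes of `P⁺` of norm `m`. [cite: HeckeMathZ1920, §7] -/
def primeFamily (m : ℕ) : Finset (HeightOneSpectrum (𝓞 K)) :=
  (primesOfNorm K m).filter fun v ↦ IsPosPrincipal K v.asIdeal

/-- The fibre of the trivial narrow class is `P⁺`. [folklore] -/
theorem frobFiber_one_eq :
    frobFiber ⊤ (primeRayClass ⊤ (top_ne_bot_ideal (K := K))) (1 : NCl K) =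
      {v : HeightOneSpectrum (𝓞 K) | IsPosPrincipal K v.asIdeal} := by
  ext v
  rw [frobFiber, Set.mem_setOf_eq, Set.mem_setOf_eq, ← nclass_asIdeal, nclass_eq_one_iff v.ne_bot]
  exact ⟨fun h ↦ h.2, fun h ↦ ⟨fun h' ↦ v.isPrime.ne_top (top_le_iff.1 h'), h⟩⟩

/-- `#primeFamily m` is the tree's `primeNormCount` of the fibre of the trivial narrow class.
[folklore] -/
theorem card_primeFamily (m : ℕ) :
    (primeFamily K m).card = primeNormCount K (frobFiber ⊤ (primeRayClass ⊤ (top_ne_bot_ideal (K := K))) (1 : NCl K)) m := by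
  rw [primeNormCount, frobFiber_one_eq, primeFamily]
  rfl

/-- **The Weyl sums over the primes of `P⁺` through cone characters and narrow class characters**:
`∑_{𝔭 ∈ P⁺, N𝔭 = m} e_k(𝔭) = (1/h⁺) ∑_χ ∑_{N𝔭 = m} (χ̃ν)(𝔭)`. [cite: HeckeMathZ1920, §7] -/
theorem sum_primeFamily_eq {ν : Ideal (𝓞 K) →*₀ ℂ} {k : Fin (finrank ℝ (logSpace K)) → ℤ}
    (hν : IsConeChar K ν (freq K k)) (m : ℕ) :
    ∑ v ∈ primeFamily K m, echar (posUnitLattice K) k (logPt K v.asIdeal) =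
      ((Nat.card (NCl K) : ℂ))⁻¹ * ∑ χ : AddChar (Additive (NCl K)) ℂ,
        ∑ v ∈ primesOfNorm K m, mulChar (nchar χ) ν v.asIdeal := by
  have hh : (Nat.card (NCl K) : ℂ) ≠ 0 := by exact_mod_cast card_NCl_pos.ne'
  rw [primeFamily, Finset.sum_filter]
  conv_rhs => rw [Finset.sum_comm, Finset.mul_sum]
  refine Finset.sum_congr rfl fun v _ ↦ ?_
  simp only [mulChar_apply]
  rw [← Finset.sum_mul, sum_nchar v.ne_bot]
  split_ifs with hv
  · rw [echar_logPt_eq hν hv, ← mul_assoc, inv_mul_cancel₀ hh, one_mul]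
  · rw [zero_mul, mul_zero]

/-- Regrouped Weyl sums over the primes of `P⁺`, weighted. [folklore] -/
theorem weylSum_primes_eq {ν : Ideal (𝓞 K) →*₀ ℂ} {k : Fin (finrank ℝ (logSpace K)) → ℤ}
    (hν : IsConeChar K ν (freq K k)) (x : ℝ) (w : ℂ) :
    (∑ m ∈ Icc 1 ⌊x⌋₊, ∑ v ∈ primeFamily K m, echar (posUnitLattice K) k (logPt K v.asIdeal)) * w =
      ((Nat.card (NCl K) : ℂ))⁻¹ * ∑ χ : AddChar (Additive (NCl K)) ℂ,
        ((∑ m ∈ Icc 1 ⌊x⌋₊, ∑ v ∈ primesOfNorm K m, mulChar (nchar χ) ν v.asIdeal) * w) := by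
  rw [Finset.sum_congr rfl fun m _ ↦ sum_primeFamily_eq hν m, ← Finset.mul_sum, Finset.sum_comm, mul_assoc,
    Finset.sum_mul]

/-- The Weyl sums of nonzero frequency over the primes of `P⁺` are `o(x/log x)`.
[cite: HeckeMathZ1920, §7] -/
theorem tendsto_weyl_primes [IsTotallyReal K] {k : Fin (finrank ℝ (logSpace K)) → ℤ} (hk : k ≠ 0) :
    Tendsto (fun x : ℝ ↦ (∑ m ∈ Icc 1 ⌊x⌋₊, ∑ v ∈ primeFamily K m, echar (posUnitLattice K) k (logPt K v.asIdeal)) *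
      (((Real.log x) ^ 1 / x : ℝ) : ℂ)) atTop (𝓝 0) := by
  obtain ⟨ν, hν⟩ := exists_coneChar_freq k
  have heq : (fun x : ℝ ↦ (∑ m ∈ Icc 1 ⌊x⌋₊, ∑ v ∈ primeFamily K m, echar (posUnitLattice K) k (logPt K v.asIdeal)) *
      (((Real.log x) ^ 1 / x : ℝ) : ℂ)) = fun x ↦ ((Nat.card (NCl K) : ℂ))⁻¹ * ∑ χ : AddChar (Additive (NCl K)) ℂ,
        ((∑ m ∈ Icc 1 ⌊x⌋₊, ∑ v ∈ primesOfNorm K m, mulChar (nchar χ) ν v.asIdeal) * (((Real.log x) ^ 1 / x : ℝ) : ℂ)) :=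
    funext fun x ↦ weylSum_primes_eq hν x _
  rw [heq]
  have hlim : ∀ χ : AddChar (Additive (NCl K)) ℂ,
      Tendsto (fun x : ℝ ↦ (∑ m ∈ Icc 1 ⌊x⌋₊, ∑ v ∈ primesOfNorm K m, mulChar (nchar χ) ν v.asIdeal) *
        (((Real.log x) ^ 1 / x : ℝ) : ℂ)) atTop (𝓝 0) := by
    intro χ
    have hc : IsConeChar K (mulChar (nchar χ) ν) (0 + freq K k) := (isConeChar_nchar χ).mul hν
    rw [zero_add] at hc
    have h := tendsto_sum_primes_mul_log_div hc (freq_ne_zero hk)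
    refine tendsto_floor_transfer (a := fun N : ℕ ↦ ∑ m ∈ Icc 1 N, ∑ v ∈ primesOfNorm K m, mulChar (nchar χ) ν v.asIdeal)
      1 (h.congr fun N ↦ ?_)
    push_cast; ring
  have := (tendsto_finsetSum (Finset.univ) fun χ _ ↦ hlim χ).const_mul ((Nat.card (NCl K) : ℂ))⁻¹
  rwa [Finset.sum_const_zero, mul_zero] at this

/-- The number of primes of `P⁺` of norm `≤ x` is `∼ x/(h⁺ log x)` (narrow-class prime number
theorem). [cite: Landau1918Idealklassen, §1] -/
theorem tendsto_count_primes :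
    Tendsto (fun x : ℝ ↦ (∑ m ∈ Icc 1 ⌊x⌋₊, ∑ v ∈ primeFamily K m, echar (posUnitLattice K) 0 (logPt K v.asIdeal)) *
      (((Real.log x) ^ 1 / x : ℝ) : ℂ)) atTop (𝓝 (((1 / Nat.card (NCl K) : ℝ)) : ℂ)) := by
  have h := tendsto_sum_primeNormCount_frobFiber_mul_log_div (K := K) (f := primeRayClass ⊤ (top_ne_bot_ideal (K := K)))
    (top_ne_bot_ideal (K := K)) (artinKillsRay_primeRayClass (top_ne_bot_ideal (K := K)))
    (exists_charFun_primeRayClass_ne_one (top_ne_bot_ideal (K := K))) (1 : NCl K)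
  have h' : Tendsto (fun N : ℕ ↦ ((∑ m ∈ Icc 1 N, ((primeFamily K m).card : ℂ))) * (((Real.log N) ^ 1 / N : ℝ) : ℂ))
      atTop (𝓝 (((1 / Nat.card (NCl K) : ℝ)) : ℂ)) := by
    have := (Complex.continuous_ofReal.tendsto _).comp h
    refine this.congr fun N ↦ ?_
    simp only [Function.comp_apply, card_primeFamily]
    push_cast; ring
  refine (tendsto_floor_transfer 1 h').congr fun x ↦ ?_
  simp only [echar_zero, Finset.sum_const, nsmul_eq_mul, mul_one]

/-- **Equidistribution of the primes of `P⁺` modulo the totally positive units** (Hecke):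
density `1/h⁺`, normalisation `x/log x`. [cite: HeckeMathZ1920, §7] -/
theorem equidistributed_primes [IsTotallyReal K] :
    MitsuiSum.Equidistributed (posUnitLattice K) MeasureTheory.volume (primeFamily K)
      (fun v ↦ logPt K v.asIdeal) 1 (1 / Nat.card (NCl K)) := by
  intro g hg hper
  refine tendsto_sum_of_tendsto_echar (L := posUnitLattice K) (μ := MeasureTheory.volume) (primeFamily K)
    (fun v ↦ logPt K v.asIdeal) 1 (by positivity) (fun k ↦ ?_) hg hper
  by_cases hk : k = 0
  · subst hk; simp only [if_true]; exact tendsto_count_primes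
  · simp only [hk, if_false]; exact tendsto_weyl_primes hk

/-! ## The ideals of `P⁺` -/

variable (K) in
/-- The ideals of `P⁺` of norm `m`. [cite: HeckeMathZ1920, §7] -/
def idealFamily (m : ℕ) : Finset (Ideal (𝓞 K)) := (NumberField.idealsOfNorm K m).filter (IsPosPrincipal K)

/-- **The Weyl sums over the ideals of `P⁺`**: `∑_{𝔞 ∈ P⁺, N𝔞 = m} e_k(𝔞) = (1/h⁺) ∑_χ twistCount (χ̃ν) m`
for `m ≠ 0`. [cite: HeckeMathZ1920, §7] -/
theorem sum_idealFamily_eq {ν : Ideal (𝓞 K) →*₀ ℂ} {k : Fin (finrank ℝ (logSpace K)) → ℤ}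
    (hν : IsConeChar K ν (freq K k)) {m : ℕ} (hm : m ≠ 0) :
    ∑ I ∈ idealFamily K m, echar (posUnitLattice K) k (logPt K I) =
      ((Nat.card (NCl K) : ℂ))⁻¹ * ∑ χ : AddChar (Additive (NCl K)) ℂ,
        NumberField.twistCount K (mulChar (nchar χ) ν) m := by
  have hh : (Nat.card (NCl K) : ℂ) ≠ 0 := by exact_mod_cast card_NCl_pos.ne'
  unfold NumberField.twistCount
  rw [idealFamily, Finset.sum_filter, Finset.sum_comm, Finset.mul_sum]
  refine Finset.sum_congr rfl fun I hI ↦ ?_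
  have hI0 : I ≠ ⊥ := by
    intro h; rw [NumberField.mem_idealsOfNorm, h, Ideal.absNorm_bot] at hI; exact hm hI.symm
  simp only [mulChar_apply, ← Finset.sum_mul, sum_nchar hI0]
  split_ifs with hv
  · rw [echar_logPt_eq hν hv, ← mul_assoc, inv_mul_cancel₀ hh, one_mul]
  · rw [zero_mul, mul_zero]

/-- The Weyl sums of nonzero frequency over the ideals of `P⁺` are `o(x)` (indeed
`O(x^{1−1/(2d)})`). [cite: HeckeMathZ1920, §7] -/
theorem tendsto_weyl_ideals [IsTotallyReal K] {k : Fin (finrank ℝ (logSpace K)) → ℤ} (hk : k ≠ 0) :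
    Tendsto (fun x : ℝ ↦ (∑ m ∈ Icc 1 ⌊x⌋₊, ∑ I ∈ idealFamily K m, echar (posUnitLattice K) k (logPt K I)) *
      (((Real.log x) ^ 0 / x : ℝ) : ℂ)) atTop (𝓝 0) := by
  obtain ⟨ν, hν⟩ := exists_coneChar_freq k
  -- each character sum is `O(x^{1-1/(2d)})`
  have hbound : ∀ χ : AddChar (Additive (NCl K)) ℂ, ∃ C : ℝ, ∀ x : ℝ, 1 ≤ x →
      ‖∑ m ∈ Icc 1 ⌊x⌋₊, NumberField.twistCount K (mulChar (nchar χ) ν) m‖ ≤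
        C * x ^ (1 - 1 / (2 * (finrank ℚ K : ℝ))) := by
    intro χ
    have hc : IsConeChar K (mulChar (nchar χ) ν) (0 + freq K k) := (isConeChar_nchar χ).mul hν
    rw [zero_add] at hc
    exact norm_sum_twistCount_le hc (Or.inl (freq_ne_zero hk))
  choose C hC using hbound
  have hd : (0 : ℝ) < 1 / (2 * (finrank ℚ K : ℝ)) := by
    have : (0 : ℝ) < finrank ℚ K := by exact_mod_cast finrank_pos
    positivity
  rw [tendsto_zero_iff_norm_tendsto_zero]
  have hmajor : Tendsto (fun x : ℝ ↦ ((Nat.card (NCl K) : ℝ))⁻¹ * (∑ χ, |C χ|) * x ^ (-(1 / (2 * (finrank ℚ K : ℝ))))) atTop (𝓝 0) := by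
    have := (tendsto_rpow_neg_atTop hd).const_mul (((Nat.card (NCl K) : ℝ))⁻¹ * ∑ χ, |C χ|)
    rwa [mul_zero] at this
  refine squeeze_zero' (Eventually.of_forall fun x ↦ norm_nonneg _) ?_ hmajor
  filter_upwards [eventually_ge_atTop (1 : ℝ)] with x hx
  have hx0 : 0 < x := by linarith
  rw [Finset.sum_congr rfl fun m hm ↦ sum_idealFamily_eq hν (Nat.one_le_iff_ne_zero.1 (Finset.mem_Icc.1 hm).1),
    ← Finset.mul_sum, Finset.sum_comm, norm_mul, norm_mul, norm_inv, Complex.norm_natCast, Complex.norm_real,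
    pow_zero, Real.norm_of_nonneg (by positivity : (0 : ℝ) ≤ 1 / x)]
  have hsum : ‖∑ χ : AddChar (Additive (NCl K)) ℂ, ∑ m ∈ Icc 1 ⌊x⌋₊, NumberField.twistCount K (mulChar (nchar χ) ν) m‖ ≤
      (∑ χ, |C χ|) * x ^ (1 - 1 / (2 * (finrank ℚ K : ℝ))) := by
    refine (norm_sum_le _ _).trans ?_
    rw [Finset.sum_mul]
    exact Finset.sum_le_sum fun χ _ ↦ (hC χ x hx).trans (mul_le_mul_of_nonneg_right (le_abs_self _) (by positivity))
  have hcard : (0 : ℝ) ≤ ((Nat.card (NCl K) : ℝ))⁻¹ := by positivity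
  calc ((Nat.card (NCl K) : ℝ))⁻¹ * ‖∑ χ : AddChar (Additive (NCl K)) ℂ, ∑ m ∈ Icc 1 ⌊x⌋₊,
          NumberField.twistCount K (mulChar (nchar χ) ν) m‖ * (1 / x)
      ≤ ((Nat.card (NCl K) : ℝ))⁻¹ * ((∑ χ, |C χ|) * x ^ (1 - 1 / (2 * (finrank ℚ K : ℝ)))) * (1 / x) := by
        gcongr
    _ = ((Nat.card (NCl K) : ℝ))⁻¹ * (∑ χ, |C χ|) * x ^ (-(1 / (2 * (finrank ℚ K : ℝ)))) := by
        rw [Real.rpow_sub hx0, Real.rpow_one, Real.rpow_neg hx0.le]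
        field_simp

/-- `#idealsLE x` is Mathlib's count of nonzero ideals of norm `≤ x`. [folklore] -/
theorem card_idealsLE_eq_natCard (x : ℝ) :
    (NumberField.idealsLE K x).card =
      Nat.card {I : nonZeroDivisors (Ideal (𝓞 K)) // (Ideal.absNorm (I : Ideal (𝓞 K)) : ℝ) ≤ x} := by
  rw [← Nat.card_eq_finsetCard]
  refine Nat.card_congr ⟨fun I ↦ ⟨⟨I.1, mem_nonZeroDivisors_of_ne_zero (NumberField.mem_idealsLE.1 I.2).1⟩,
    (NumberField.mem_idealsLE.1 I.2).2⟩, fun I ↦ ⟨I.1.1, NumberField.mem_idealsLE.2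
      ⟨nonZeroDivisors.ne_zero I.1.2, I.2⟩⟩, fun I ↦ rfl, fun I ↦ rfl⟩

/-- `twistCount` of the trivial-class character counts the ideals of norm `m ≥ 1`. [folklore] -/
theorem twistCount_nchar_zero {m : ℕ} (hm : m ≠ 0) :
    NumberField.twistCount K (nchar (0 : AddChar (Additive (NCl K)) ℂ)) m = (NumberField.idealsOfNorm K m).card := by
  unfold NumberField.twistCount
  rw [Finset.card_eq_sum_ones, Nat.cast_sum, Nat.cast_one]
  refine Finset.sum_congr rfl fun I hI ↦ ?_
  have hI0 : I ≠ ⊥ := by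
    intro h; rw [NumberField.mem_idealsOfNorm, h, Ideal.absNorm_bot] at hI; exact hm hI.symm
  rw [nchar_apply_of_ne_bot _ hI0, toMulHom_apply, AddChar.zero_apply]

/-- `∑_{m ≤ x} #idealsOfNorm m = #idealsLE x`. [folklore] -/
theorem sum_card_idealsOfNorm_eq (x : ℝ) (hx : 0 ≤ x) :
    ∑ m ∈ Icc 1 ⌊x⌋₊, ((NumberField.idealsOfNorm K m).card : ℂ) = (NumberField.idealsLE K x).card := by
  have h := sum_Icc_twistCount_eq (nchar (0 : AddChar (Additive (NCl K)) ℂ)) hx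
  rw [Finset.sum_congr rfl fun m hm ↦ twistCount_nchar_zero (Nat.one_le_iff_ne_zero.1 (Finset.mem_Icc.1 hm).1)] at h
  rw [h, Finset.card_eq_sum_ones, Nat.cast_sum, Nat.cast_one]
  refine Finset.sum_congr rfl fun I hI ↦ ?_
  rw [nchar_apply_of_ne_bot _ (NumberField.mem_idealsLE.1 hI).1, toMulHom_apply, AddChar.zero_apply]

/-- `#(idealFamily m) = (1/h⁺) ∑_χ twistCount χ̃ m` for `m ≠ 0` (orthogonality). [folklore] -/
theorem card_idealFamily_eq {m : ℕ} (hm : m ≠ 0) :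
    ((idealFamily K m).card : ℂ) = ((Nat.card (NCl K) : ℂ))⁻¹ * ∑ χ : AddChar (Additive (NCl K)) ℂ,
      NumberField.twistCount K (nchar χ) m := by
  have hh : (Nat.card (NCl K) : ℂ) ≠ 0 := by exact_mod_cast card_NCl_pos.ne'
  rw [Finset.card_eq_sum_ones, Nat.cast_sum, Nat.cast_one]
  unfold NumberField.twistCount
  rw [idealFamily, Finset.sum_filter, Finset.sum_comm, Finset.mul_sum]
  refine Finset.sum_congr rfl fun I hI ↦ ?_
  have hI0 : I ≠ ⊥ := by
    intro h; rw [NumberField.mem_idealsOfNorm, h, Ideal.absNorm_bot] at hI; exact hm hI.symm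
  rw [sum_nchar hI0]
  split_ifs
  · rw [inv_mul_cancel₀ hh]
  · rw [mul_zero]

/-- The number of ideals of `P⁺` of norm `≤ x` is `∼ ρ_K x / h⁺`. [cite: HeckeMathZ1920, §7] -/
theorem tendsto_count_ideals [IsTotallyReal K] :
    Tendsto (fun x : ℝ ↦ (∑ m ∈ Icc 1 ⌊x⌋₊, ∑ I ∈ idealFamily K m, echar (posUnitLattice K) 0 (logPt K I)) *
      (((Real.log x) ^ 0 / x : ℝ) : ℂ)) atTop (𝓝 (((dedekindZeta_residue K / Nat.card (NCl K) : ℝ)) : ℂ)) := by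
  have hh : (Nat.card (NCl K) : ℂ) ≠ 0 := by exact_mod_cast card_NCl_pos.ne'
  -- the character sums
  set T : AddChar (Additive (NCl K)) ℂ → ℝ → ℂ :=
    fun χ x ↦ (∑ m ∈ Icc 1 ⌊x⌋₊, NumberField.twistCount K (nchar χ) m) * (((Real.log x) ^ 0 / x : ℝ) : ℂ) with hT
  -- principal character: Mathlib's ideal count
  have hmain : Tendsto (T 0) atTop (𝓝 ((dedekindZeta_residue K : ℝ) : ℂ)) := by
    have h1 := (Complex.continuous_ofReal.tendsto _).comp (NumberField.Ideal.tendsto_norm_le_div_atTop₀ K)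
    rw [← dedekindZeta_residue_def] at h1
    refine h1.congr' ?_
    filter_upwards [eventually_ge_atTop (0 : ℝ)] with x hx
    simp only [Function.comp_apply, hT]
    rw [← card_idealsLE_eq_natCard, pow_zero,
      Finset.sum_congr rfl fun m hm ↦ twistCount_nchar_zero (K := K) (Nat.one_le_iff_ne_zero.1 (Finset.mem_Icc.1 hm).1),
      sum_card_idealsOfNorm_eq x hx]
    push_cast; ring
  -- non-principal characters: `O(x^{1-1/(2d)})`
  have herr : ∀ χ : AddChar (Additive (NCl K)) ℂ, χ ≠ 0 → Tendsto (T χ) atTop (𝓝 0) := by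
    intro χ hχ
    obtain ⟨I, hI, hne⟩ := exists_nchar_ne_one hχ
    obtain ⟨C, hC⟩ := norm_sum_twistCount_le (isConeChar_nchar χ) (Or.inr ⟨I, hI, hne⟩)
    have hd : (0 : ℝ) < 1 / (2 * (finrank ℚ K : ℝ)) := by
      have : (0 : ℝ) < finrank ℚ K := by exact_mod_cast finrank_pos
      positivity
    rw [tendsto_zero_iff_norm_tendsto_zero]
    have hmajor : Tendsto (fun x : ℝ ↦ |C| * x ^ (-(1 / (2 * (finrank ℚ K : ℝ))))) atTop (𝓝 0) := by
      have := (tendsto_rpow_neg_atTop hd).const_mul |C|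
      rwa [mul_zero] at this
    refine squeeze_zero' (Eventually.of_forall fun x ↦ norm_nonneg _) ?_ hmajor
    filter_upwards [eventually_ge_atTop (1 : ℝ)] with x hx
    have hx0 : 0 < x := by linarith
    simp only [hT]
    rw [norm_mul, Complex.norm_real, pow_zero, Real.norm_of_nonneg (by positivity : (0 : ℝ) ≤ 1 / x)]
    calc ‖∑ m ∈ Icc 1 ⌊x⌋₊, NumberField.twistCount K (nchar χ) m‖ * (1 / x)
        ≤ |C| * x ^ (1 - 1 / (2 * (finrank ℚ K : ℝ))) * (1 / x) := by
          refine mul_le_mul_of_nonneg_right ((hC x hx).trans ?_) (by positivity)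
          exact mul_le_mul_of_nonneg_right (le_abs_self C) (by positivity)
      _ = |C| * x ^ (-(1 / (2 * (finrank ℚ K : ℝ)))) := by
          rw [Real.rpow_sub hx0, Real.rpow_one, Real.rpow_neg hx0.le]
          field_simp
  -- all characters together
  have hall : Tendsto (fun x : ℝ ↦ ∑ χ : AddChar (Additive (NCl K)) ℂ, T χ x) atTop (𝓝 ((dedekindZeta_residue K : ℝ) : ℂ)) := by
    have hsplit : ∀ x : ℝ, ∑ χ : AddChar (Additive (NCl K)) ℂ, T χ x =
        T 0 x + ∑ χ ∈ (Finset.univ : Finset (AddChar (Additive (NCl K)) ℂ)).erase 0, T χ x :=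
      fun x ↦ (Finset.add_sum_erase _ _ (Finset.mem_univ _)).symm
    simp_rw [hsplit]
    have h2 : Tendsto (fun x : ℝ ↦ ∑ χ ∈ (Finset.univ : Finset (AddChar (Additive (NCl K)) ℂ)).erase 0, T χ x)
        atTop (𝓝 0) := by
      have := tendsto_finsetSum ((Finset.univ : Finset (AddChar (Additive (NCl K)) ℂ)).erase 0)
        fun χ hχ ↦ herr χ (Finset.ne_of_mem_erase hχ)
      rwa [Finset.sum_const_zero] at this
    have := hmain.add h2
    rwa [add_zero] at this
  have hfinal := hall.const_mul ((Nat.card (NCl K) : ℂ))⁻¹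
  have hlim : ((Nat.card (NCl K) : ℂ))⁻¹ * ((dedekindZeta_residue K : ℝ) : ℂ) = (((dedekindZeta_residue K / Nat.card (NCl K) : ℝ)) : ℂ) := by
    push_cast; ring
  rw [hlim] at hfinal
  refine hfinal.congr fun x ↦ ?_
  simp only [hT, echar_zero, Finset.sum_const, nsmul_eq_mul, mul_one, ← Finset.sum_mul, ← mul_assoc]
  congr 1
  symm
  rw [Finset.sum_congr rfl fun m hm ↦ card_idealFamily_eq (K := K) (Nat.one_le_iff_ne_zero.1 (Finset.mem_Icc.1 hm).1),
    ← Finset.mul_sum, Finset.sum_comm, Finset.mul_sum]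

/-- **Equidistribution of the ideals of `P⁺` modulo the totally positive units**: density
`ρ_K/h⁺`, normalisation `x`. [cite: HeckeMathZ1920, §7] -/
theorem equidistributed_ideals [IsTotallyReal K] :
    MitsuiSum.Equidistributed (posUnitLattice K) MeasureTheory.volume (idealFamily K) (logPt K) 0
      (dedekindZeta_residue K / Nat.card (NCl K)) := by
  intro g hg hper
  have hρ : 0 ≤ dedekindZeta_residue K / Nat.card (NCl K) :=
    div_nonneg (dedekindZeta_residue_pos K).le (Nat.cast_nonneg _)
  refine tendsto_sum_of_tendsto_echar (L := posUnitLattice K) (μ := MeasureTheory.volume) (idealFamily K)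
    (logPt K) 0 hρ (fun k ↦ ?_) hg hper
  by_cases hk : k = 0
  · subst hk; simp only [if_true]; exact tendsto_count_ideals
  · simp only [hk, if_false]; exact tendsto_weyl_ideals hk

end Literature.NumberTheory.LFunctions.HeckeCone

end
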